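import Mathlib
import Summits.ResolutionOfSingularities.ResolutionOfSingularities.Theorems.WeightedInvariantLocalWeightedDropNCResSettingHeadDropCurve
import Summits.ResolutionOfSingularities.ResolutionOfSingularities.Theorems.WeightedInvariantLocalWeightedDropTOT2E1Decorated
import Summits.ResolutionOfSingularities.ResolutionOfSingularities.Theorems.WeightedInvariantLocalWeightedDropNCResSettingHeadDropB

/-!
# `WeightedInvariant.LocalWeightedDrop` ENGINE, W′|₄ line — D₃ᴮ object (9): THE APEX-COLUMN REGIME IN B-FORM, STEP THEOREMS (HAND B, 1/2)

Sub-problem `ResolutionOfSingularities`, ENGINE crux `stmt-ResolutionOfSingularities-8899` (`LocalWeightedDrop`), registered stub W′|₄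
`stub_wildWideApexFourStartsWon`; res-L1-w43-plan-1 RULING 2026-08-27T21:45:42Z (D₃ᴮ lane), hand B = the hypothesis `hH` of `surfaceBoundaryNC_of_regimesB`
(the apex column `e^O ≤ 1`; D-form `GraphCurve.dWinsTo_headDrop_of_hCol` = E0 + S-E1 + S-E1-CURVE).  [OURS · L1 W4.3 · chain w43 · res-L1-w43-lead-1 g6;
def-free; RE-THREADS over `DBWinsTo` (p575221) of res-L1-w43-stub-1's `dWinsTo_headDrop_of_apexLine_curve` (…NCResSettingHeadDropCurve) and of
res-type-056's S-E1 `TOT2E1.dWinsTo_headDrop_of_presentation` / `dWinsTo_headDrop_of_isolated` (…TOT2E1Decorated): the moves there are a HYPOTHESISED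
B-permissible move resp. the identity point blow-up (`isBPermissible_point_X`), the successor decorations are the transforms — the same proofs.  Nothing
here is a statement of any manuscript; AI-produced, gate-checked, weaker than expert review.]

* `dbWinsTo_headDrop_of_apexLine_curve` — a B-permissible centre of positive dimension at apex dimension `≤ 1` B-wins the head phase in one move;
* `TOT2E1.dbWinsTo_headDrop_of_presentation`, `TOT2E1.dbWinsTo_headDrop_of_isolated` — S-E1 in B-form.
-/

set_option linter.dupNamespace false -- mandated namespace of this single-conjunct summit

noncomputable section

namespace Summit.ResolutionOfSingularities.ResolutionOfSingularities.Theorems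

namespace TameFourTupleDrop

open MvPowerSeries Literature.AlgebraicGeometry.Resolution AxisPolyhedron

variable {k : Type} [Field k] {m : ℕ}

/-- **A B-PERMISSIBLE CENTRE OF POSITIVE DIMENSION AT APEX DIMENSION ≤ 1 B-WINS THE HEAD PHASE IN ONE MOVE** (OURS · L1 W4.3; re-thread of
`dWinsTo_headDrop_of_apexLine_curve`): from an
admissibly decorated position, a B-permissible move `(Φ, w)` with a weight-`0` slot, when every two invariance vectors of `in_c g` are dependent
(`g = f·∏_O x_l`, `e(g) ≤ 1`, hypothesis in the position's OWN coordinates), forces «admissibly decorated of smaller head» in one move: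
by directrix transport and res-L1-w43-stub-3's (N3) every answer is non-near. -/
theorem dbWinsTo_headDrop_of_apexLine_curve {b : MvPowerSeries (Fin (m + 1)) k} {δ : Decoration k m} (hadm : Admissible b δ)
    {Φ : Fin (m + 1) → MvPowerSeries (Fin (m + 1)) k} {w : Fin (m + 1) → ℕ} (hperm : IsBPermissible δ Φ w)
    {l₀ : Fin (m + 1)} (hl₀ : w l₀ = 0)
    (hone : ∀ u₁ u₂ : Fin (m + 1) → k,
      (∀ v, CobordantChart.initEval (fun _ : Fin (m + 1) => 1) (v + u₁) δ.c (δ.f * ∏ l ∈ δ.O, X l) =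
        CobordantChart.initEval (fun _ : Fin (m + 1) => 1) v δ.c (δ.f * ∏ l ∈ δ.O, X l)) →
      (∀ v, CobordantChart.initEval (fun _ : Fin (m + 1) => 1) (v + u₂) δ.c (δ.f * ∏ l ∈ δ.O, X l) =
        CobordantChart.initEval (fun _ : Fin (m + 1) => 1) v δ.c (δ.f * ∏ l ∈ δ.O, X l)) →
      ∃ α β : k, (α ≠ 0 ∨ β ≠ 0) ∧ α • u₁ + β • u₂ = 0) :
    DBWinsTo (fun τ : MvPowerSeries (Fin (m + 1)) k × Decoration k m => Admissible τ.1 τ.2 ∧ τ.2.head < δ.head) (b, δ) := by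
  have hmv : IsCountMove Φ w := hperm.1
  have hP3 := hperm.2.2.2
  have hordΦ : (subst Φ (δ.f * ∏ l ∈ δ.O, X l)).order = (δ.c : ℕ∞) := Decoration.order_subst_totalO hadm hmv
  have hP1g : (δ.c : ℕ∞) ≤ (subst Φ (δ.f * ∏ l ∈ δ.O, X l)).weightedOrder w := by
    rw [← hordΦ]
    exact (isBPermissible_iff_totalO hmv hadm.2.1.ne_zero hP3).mp hperm
  refine dbWinsTo_headDrop_of_orderDrop hadm hperm fun c hc hc0 A G hfac hG i hci => ?_
  obtain ⟨hA, -⟩ := Decoration.order_slice_totalO_eq hperm hc hadm.2.1.ne_zero hci hfac hG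
  subst hA
  exact TOT2Near.order_slice_lt_of_apexLine_curve w c hmv.2.2.1 hc i hci _ hP1g
    (apexLine_subst_legal Φ hmv.1 hmv.2.1 _ (Decoration.order_totalO hadm) hone) hl₀ hfac

end TameFourTupleDrop

open Literature.AlgebraicGeometry.Resolution

namespace TOT2E1

open MvPowerSeries AxisPolyhedron TameFourTupleDrop

variable {k : Type} [Field k] {m : ℕ}

/-- **S-E1, DECORATED, B-FORM** (re-thread of `dWinsTo_headDrop_of_presentation`: identity point blow-ups, transforms as successors): **FROM A STATE WHOSE PRODUCT `g = f · ∏_{l∈O} x_l` HAS A PREPARED AXIS PRESENTATION THE MOVER FORCES A HEAD DROP.**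
See the module docstring.  States: `(position, decoration)`, `germ := Prod.fst`; hypotheses: admissible, `2 ≤ o`, a prepared axis
presentation of the product at `d = c` with a failing integer level; conclusion: `DWinsTo` towards «admissibly decorated with smaller head». -/
theorem dbWinsTo_headDrop_of_presentation [Infinite k] {b : MvPowerSeries (Fin (m + 1)) k} {δ : Decoration k m}
    (hadm : Admissible b δ) (ho : 2 ≤ δ.o)
    (hpres : ∃ (θ : Fin (m + 1) → MvPowerSeries (Fin (m + 1)) k) (u P : MvPowerSeries (Fin (m + 1)) k) (r : ℕ),
      (∀ l, constantCoeff (θ l) = 0) ∧ IsUnit (Matrix.det (Matrix.of fun a j : Fin (m + 1) => coeff (Finsupp.single j 1) (θ a))) ∧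
      constantCoeff u ≠ 0 ∧ subst θ (δ.f * ∏ l ∈ δ.O, X l) = u * P ∧
      AxisCone δ.c P ∧ TrivialApexX δ.c P ∧ PreparedAxis δ.c P ∧ ¬ AboveLevel δ.c r 1 P) :
    DBWinsTo (fun τ : MvPowerSeries (Fin (m + 1)) k × Decoration k m => Admissible τ.1 τ.2 ∧ τ.2.head < δ.head) (b, δ) := by
  classical
  -- the two kinds of states of the regime: «has a presentation with failing level r» and «apex-free»
  set Pres : (MvPowerSeries (Fin (m + 1)) k × Decoration k m) → ℕ → Prop := fun τ r =>
    ∃ (θ : Fin (m + 1) → MvPowerSeries (Fin (m + 1)) k) (u P : MvPowerSeries (Fin (m + 1)) k),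
      (∀ l, constantCoeff (θ l) = 0) ∧ IsUnit (Matrix.det (Matrix.of fun a j : Fin (m + 1) => coeff (Finsupp.single j 1) (θ a))) ∧
      constantCoeff u ≠ 0 ∧ subst θ (τ.2.f * ∏ l ∈ τ.2.O, X l) = u * P ∧
      AxisCone τ.2.c P ∧ TrivialApexX τ.2.c P ∧ PreparedAxis τ.2.c P ∧ ¬ AboveLevel τ.2.c r 1 P with hPres
  set AF : (MvPowerSeries (Fin (m + 1)) k × Decoration k m) → Prop := fun τ =>
    ∀ v : Fin (m + 1) → k, (∀ x, CobordantChart.initEval (fun _ : Fin (m + 1) => 1) (x + v) τ.2.c (τ.2.f * ∏ l ∈ τ.2.O, X l) =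
      CobordantChart.initEval (fun _ : Fin (m + 1) => 1) x τ.2.c (τ.2.f * ∏ l ∈ τ.2.O, X l)) → v = 0 with hAF
  set Cl : Set (MvPowerSeries (Fin (m + 1)) k × Decoration k m) :=
    {τ | Admissible τ.1 τ.2 ∧ τ.2.head = δ.head ∧ ((∃ r, Pres τ r) ∨ AF τ)} with hCl
  set μ : (MvPowerSeries (Fin (m + 1)) k × Decoration k m) → Ordinal.{0} := fun τ =>
    ((sInf {N : ℕ | (AF τ ∧ N = 0) ∨ ∃ r, Pres τ r ∧ N = r + 1} : ℕ) : Ordinal.{0}) with hμ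
  -- measure bookkeeping
  have hμ_le_AF : ∀ τ, AF τ → μ τ = 0 := by
    intro τ h
    have hmem : (0 : ℕ) ∈ {N : ℕ | (AF τ ∧ N = 0) ∨ ∃ r, Pres τ r ∧ N = r + 1} := Or.inl ⟨h, rfl⟩
    have h0 : sInf {N : ℕ | (AF τ ∧ N = 0) ∨ ∃ r, Pres τ r ∧ N = r + 1} = 0 := Nat.eq_zero_of_le_zero (Nat.sInf_le hmem)
    simp only [hμ, h0, Nat.cast_zero]
  have hμ_le_Pres : ∀ τ r, Pres τ r → μ τ ≤ ((r + 1 : ℕ) : Ordinal.{0}) := by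
    intro τ r h
    have hmem : r + 1 ∈ {N : ℕ | (AF τ ∧ N = 0) ∨ ∃ r, Pres τ r ∧ N = r + 1} := Or.inr ⟨r, h, rfl⟩
    exact Nat.cast_le.mpr (Nat.sInf_le hmem)
  have hμ_eq : ∀ τ, ¬ AF τ → (∃ r, Pres τ r) → ∃ r, Pres τ r ∧ μ τ = ((r + 1 : ℕ) : Ordinal.{0}) := by
    intro τ hnaf ⟨r₀, h₀⟩
    have hne : ({N : ℕ | (AF τ ∧ N = 0) ∨ ∃ r, Pres τ r ∧ N = r + 1} : Set ℕ).Nonempty := ⟨r₀ + 1, Or.inr ⟨r₀, h₀, rfl⟩⟩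
    rcases Nat.sInf_mem hne with ⟨haf, -⟩ | ⟨r, hr, hN⟩
    · exact absurd haf hnaf
    · exact ⟨r, hr, by simp only [hμ, hN]⟩
  obtain ⟨θ₀, u₀, P₀, r₀', hpres'⟩ := hpres
  refine DBWinsTo.of_measure Cl μ ?_ ⟨hadm, rfl, Or.inl ⟨r₀', θ₀, u₀, P₀, hpres'⟩⟩
  -- THE STEP: from `τ ∈ Cl`, play the identity point blow-up
  rintro ⟨bτ, δτ⟩ ⟨hadmτ, hheadτ, hcase⟩ -
  dsimp only at hadmτ hheadτ
  have hf : δτ.f ≠ 0 := hadmτ.2.1.ne_zero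
  have hoτ : δτ.o = δ.o := by
    have h := hheadτ
    rw [Decoration.head, Decoration.head, toLex_inj, Prod.mk.injEq] at h
    exact h.1
  have hd : 1 ≤ δτ.c := by rw [Decoration.c]; omega
  have hperm := isBPermissible_point_X (k := k) δτ
  have hconv : ∀ (cc : Fin (m + 1) → k) (l : Fin (m + 1)), (fun _ : Fin (m + 1) => (1 : ℕ)) l = 0 → cc l = 0 :=
    fun cc l hl => absurd hl one_ne_zero
  refine ⟨fun j => X j, fun _ => 1, hperm, ?_⟩
  intro c _ hc0 A G hfac hG
  obtain ⟨i, hci⟩ : ∃ i, c i ≠ 0 := Function.ne_iff.mp hc0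
  set δ' := δτ.transform (fun j => (X j : MvPowerSeries (Fin (m + 1)) k)) (fun _ => 1) c i with hδ'
  have hadm' : Admissible (X 0 * TupleGame.slice i G) δ' := admissible_transform hadmτ hperm (hconv c) hfac hG hci
  have hhead' : δ'.head ≤ δτ.head := Decoration.head_transform_le hperm (hconv c) hf hci
  refine ⟨i, hci, ?_⟩
  change (Admissible (X 0 * TupleGame.slice i G) δ' ∧ δ'.head < δ.head) ∨
    ((X 0 * TupleGame.slice i G, δ') ∈ Cl ∧ μ (X 0 * TupleGame.slice i G, δ') < μ (bτ, δτ))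
  by_cases hlt : δ'.head < δτ.head
  · exact Or.inl ⟨hadm', by rw [← hheadτ]; exact hlt⟩
  right
  have heq : δ'.head = δτ.head := le_antisymm hhead' (not_lt.mp hlt)
  -- at a near answer: the new product is the slice of the old product's strict transform, of order `d = c`
  set g : MvPowerSeries (Fin (m + 1)) k := δτ.f * ∏ l ∈ δτ.O, X l with hg
  set Gg : MvPowerSeries (Fin (m + 1 + 1)) k := satPart (δτ.fChart (fun j => (X j : MvPowerSeries (Fin (m + 1)) k)) (fun _ => 1) c) *
    ∏ l ∈ δτ.O, (C (c l) + X l.succ) with hGg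
  have hgd : g.order = δτ.c := Decoration.order_totalO hadmτ
  have hfacg : subst (CobordantChart.chart (fun _ : Fin (m + 1) => 1) c) g = X 0 ^ δτ.c * Gg := chart_totalO_eq hadmτ c
  have hid : δ'.f * ∏ l ∈ δ'.O, X l = TupleGame.slice i Gg := totalO_transform_eq_slice hadmτ hci heq
  have hc' : δ'.c = δτ.c := by
    have h := heq
    rw [Decoration.head, Decoration.head, toLex_inj, Prod.mk.injEq] at h
    exact h.2
  have hordd : (TupleGame.slice i Gg).order = δτ.c := by
    rw [← hid]
    exact order_totalO_transform hadmτ hfac hG hci heq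
  rcases hcase with ⟨r₀, hP₀⟩ | hAFτ
  swap
  · -- an apex-free state has no near answer at all
    exfalso
    have hlt' := TOT2Near.order_slice_lt_of_apexTrivial g hAFτ c i hci hfacg
    rw [hordd] at hlt'
    exact lt_irrefl _ hlt'
  · -- a state with a presentation: the axis step theorem
    have hinv : ∀ r, Pres (bτ, δτ) r → ¬ AF (bτ, δτ) := by
      rintro r ⟨θ, u, P, hθ0, hθdet, hu, hgP, hcone, -, -, -⟩ haf
      obtain ⟨v, hv, hvinv⟩ := exists_invariance_of_presentation g hgd θ hθ0 hθdet u P hu hgP hcone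
      exact hv (haf v hvinv)
    obtain ⟨r, hPr, hμτ⟩ := hμ_eq (bτ, δτ) (hinv r₀ hP₀) ⟨r₀, hP₀⟩
    obtain ⟨θ, u, P, hθ0, hθdet, hu, hgP, hcone, hapex, hprep, hr⟩ := hPr
    rcases axisStep g hd hgd θ hθ0 hθdet u P hu hgP hcone hapex hprep hr hci hfacg with
      hA | ⟨-, θ', u', P', hθ'0, hθ'det, hu', hgP', hcone', hapex', hprep', hr', h3⟩ | ⟨-, hAF'⟩
    · exfalso
      rw [hordd] at hA
      exact lt_irrefl _ hA
    · -- again a presentation, one level lower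
      have hPres' : Pres (X 0 * TupleGame.slice i G, δ') (r - 1) := by
        refine ⟨θ', u', P', hθ'0, hθ'det, hu', ?_, ?_, ?_, ?_, ?_⟩
        · rw [hid]; exact hgP'
        · rw [hc']; exact hcone'
        · rw [hc']; exact hapex'
        · rw [hc']; exact hprep'
        · rw [hc']; exact hr'
      refine ⟨⟨hadm', heq.trans hheadτ, Or.inl ⟨r - 1, hPres'⟩⟩, ?_⟩
      calc μ (X 0 * TupleGame.slice i G, δ') ≤ ((r - 1 + 1 : ℕ) : Ordinal.{0}) := hμ_le_Pres _ _ hPres'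
        _ < ((r + 1 : ℕ) : Ordinal.{0}) := Nat.cast_lt.mpr (by omega)
        _ = μ (bτ, δτ) := hμτ.symm
    · -- the successor is apex-free
      have hAF' : AF (X 0 * TupleGame.slice i G, δ') := by
        intro v hv
        refine hAF' v fun x => ?_
        have h := hv x
        rwa [hid, hc'] at h
      refine ⟨⟨hadm', heq.trans hheadτ, Or.inr hAF'⟩, ?_⟩
      rw [hμ_le_AF _ hAF', hμτ]
      exact Nat.cast_lt.mpr (Nat.succ_pos r)

/-- **S-E1, DECORATED, B-FORM, WITH THE GEOMETRIC ENTRY HYPOTHESES**: admissible, `2 ≤ o`, the degree-`c` form of the product `g = f · ∏_{l∈O} x_l`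
has a ONE-DIMENSIONAL APEX (`hone`/`hcol`, the shapes of `AxisCut.axisStartsWon`: `e^O = 1`), and the point is ISOLATED in its
`(o, c)`-stratum in the strong form «no formal coordinate change makes `g` equimultiple along the axis» (no B-permissible curve centre in any
coordinates).  Then the mover forces an admissibly decorated state with smaller head. -/
theorem dbWinsTo_headDrop_of_isolated [Infinite k] {b : MvPowerSeries (Fin (m + 1)) k} {δ : Decoration k m}
    (hadm : Admissible b δ) (ho : 2 ≤ δ.o)
    (hone : ∃ v : Fin (m + 1) → k, v ≠ 0 ∧ ∀ x : Fin (m + 1) → k,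
      CobordantChart.initEval (fun _ : Fin (m + 1) => 1) (x + v) δ.c (δ.f * ∏ l ∈ δ.O, X l) =
        CobordantChart.initEval (fun _ : Fin (m + 1) => 1) x δ.c (δ.f * ∏ l ∈ δ.O, X l))
    (hcol : ∀ v₁ v₂ : Fin (m + 1) → k,
      (∀ x : Fin (m + 1) → k, CobordantChart.initEval (fun _ : Fin (m + 1) => 1) (x + v₁) δ.c (δ.f * ∏ l ∈ δ.O, X l) =
        CobordantChart.initEval (fun _ : Fin (m + 1) => 1) x δ.c (δ.f * ∏ l ∈ δ.O, X l)) →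
      (∀ x : Fin (m + 1) → k, CobordantChart.initEval (fun _ : Fin (m + 1) => 1) (x + v₂) δ.c (δ.f * ∏ l ∈ δ.O, X l) =
        CobordantChart.initEval (fun _ : Fin (m + 1) => 1) x δ.c (δ.f * ∏ l ∈ δ.O, X l)) →
      ∃ α β : k, (α ≠ 0 ∨ β ≠ 0) ∧ α • v₁ + β • v₂ = 0)
    (hisol : ∀ Φ : Fin (m + 1) → MvPowerSeries (Fin (m + 1)) k, (∀ l, constantCoeff (Φ l) = 0) →
      IsUnit (Matrix.det (Matrix.of fun a j : Fin (m + 1) => coeff (Finsupp.single j 1) (Φ a))) →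
      ¬ InAxisIdeal δ.c (subst Φ (δ.f * ∏ l ∈ δ.O, X l))) :
    DBWinsTo (fun τ : MvPowerSeries (Fin (m + 1)) k × Decoration k m => Admissible τ.1 τ.2 ∧ τ.2.head < δ.head) (b, δ) := by
  obtain ⟨θ, hθ0, hθdet, -, hcone, hapex, hprep, hfin⟩ :=
    exists_prepared_presentation (δ.f * ∏ l ∈ δ.O, X l) δ.c (Decoration.order_totalO hadm) hone hcol hisol
  obtain ⟨r, hr⟩ := AxisNearDescent.exists_not_aboveLevel_of_not_inAxisIdeal hfin
  exact dbWinsTo_headDrop_of_presentation hadm ho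
    ⟨θ, 1, subst θ (δ.f * ∏ l ∈ δ.O, X l), r, hθ0, hθdet, by rw [map_one]; exact one_ne_zero, (one_mul _).symm,
      hcone, hapex, hprep, hr⟩

end TOT2E1

end Summit.ResolutionOfSingularities.ResolutionOfSingularities.Theorems

end
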